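import Summits.BirchSwinnertonDyer.Rank1Residual.Additive.GoodModelKernelH1OfDeeplyRamified
import Literature.NumberTheory.EllipticCurves.GeomPointsGaloisModule
import HarnessLib

set_option linter.dupNamespace false -- `…BirchSwinnertonDyer.BirchSwinnertonDyer…` is the cell's nested layout (D-0017)
set_option autoImplicit false

/-!
# Galois bookkeeping for the subquotient derivation of `H¹(G, Ŵ₀(𝔪̄)) = 0`: the orbit layer
# `M ⊔ K_v(G • x)` for a general normal finite-index `U ≤ G`, restriction of continuous cocycles,
# continuous coboundaries, and the normal closure of a set fixed by a normal subgroup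

Cell `pub/bsd-print-x9`, seat `bsd-line-x10b-p1-w2` g13 (CG-FRAME road, pen GO 2026-08-29T00:29:56Z:
discharge the print leaf G-2.4 = `Greenberg1999.imKummer_eq_strictCondition_goodOrdinary_numberField`
on the routes' frames; `--supports` the crux `PrintX10b.BeyondCarrierDepthX10b`, whose stub s2c sits
behind that leaf). TOOL file for the sibling `GoodModelKernelH1OfSubquotient` (THEOREMS ONLY, no
definition, no named fact, no `sorry`); the twins of `Rank1Residual/Additive/GoodModelKernelH1Layer`
with the subgroup `G ∩ Gal(K̄_v/M)` replaced by an arbitrary normal `U ≤ G` of finite index fixing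
`x` (and `M`). BSD is not proved by any of this.

## Contents (over `Γ_{K_v} = absoluteGaloisGroup (v.adicCompletion K)`, `K̄_v = AlgebraicClosure (v.adicCompletion K)`)

* `smul_mem_range_out_smul`, `smul_mem_orbitLayer`, `smul_eq_self_of_mem_orbitLayer` — for `M`
  finite normal, `U ⊴ G` fixing `x`, the layer `M ⊔ K_v(q.out • x : q ∈ G/U)` is `G`-stable and
  fixed pointwise by every `u ∈ U` fixing `M`.
* `finite_quotient_of_le` — `G/U₂` is finite if `G/U₁` is and `U₁ ≤ U₂`.
* `exists_contOneCocycles_restrict` — restriction of a continuous crossed homomorphism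
  `G → E(K̄_v)` to a subgroup `N ≤ G`.
* `continuous_smul_localPoints`, `exists_contOneCocycles_coboundary` — the orbit map of a point of
  `E(K̄_v)` is continuous (open stabiliser), so `g ↦ g • a − a` is a continuous cocycle.
* `smul_eq_self_of_mem_normalClosure_adjoin` — a subgroup `N` NORMAL in `Γ_{K_v}` fixing a set
  `S₀` pointwise fixes the normal closure of `K_v(S₀)` pointwise (`Fix(N)` is a normal
  intermediate field).

References: J. Neukirch, *ANT* IV §1 (Krull topology) [NeukirchANT1999]; J.-P. Serre, *Galois
Cohomology* I §2, §5, II §1.1 [SerreGaloisCohomology1997]; Mathlib `FieldTheory.Galois.Infinite`,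
`FieldTheory.Normal.Closure`; tree: `Additive/GoodModelKernelH1Layer`, `GeomPointsGaloisModule`.
-/

noncomputable section

open scoped Classical NNReal Pointwise

open WeierstrassCurve NumberField IsDedekindDomain Field
  Literature.NumberTheory.GaloisRepresentations Literature.NumberTheory.EllipticCurves
  IsDedekindDomain.HeightOneSpectrum

universe u

namespace Summit.BirchSwinnertonDyer.BirchSwinnertonDyer.Theorems.GoodModelKernelH1OfSubquotient

variable {K : Type u} [Field K] [NumberField K] {v : HeightOneSpectrum (𝓞 K)}
/-! ## §1 The orbit layer `M ⊔ K_v(G • x)` for a general normal subgroup `U ≤ G` of finite index -/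

section Layer

/-- Every `k • x`, `k ∈ G`, is one of the `q.out • x`, `q ∈ G/U`, when `U` fixes `x`. [folklore] -/
theorem smul_mem_range_out_smul (G : Subgroup (absoluteGaloisGroup (v.adicCompletion K)))
    (U : Subgroup G) (x : AlgebraicClosure (v.adicCompletion K))
    (hxU : ∀ u : G, u ∈ U → (u : absoluteGaloisGroup (v.adicCompletion K)) • x = x) (k : G) :
    (k : absoluteGaloisGroup (v.adicCompletion K)) • x ∈
      Set.range fun q : G ⧸ U ↦ ((q.out : G) : absoluteGaloisGroup (v.adicCompletion K)) • x := by
  obtain ⟨u, hu⟩ := QuotientGroup.mk_out_eq_mul U k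
  refine ⟨QuotientGroup.mk k, ?_⟩
  change (((QuotientGroup.mk k : G ⧸ U).out : G) : absoluteGaloisGroup (v.adicCompletion K)) • x = _
  rw [hu, Subgroup.coe_mul, mul_smul, hxU u u.2]

/-- **`G`-stability of the layer `M ⊔ K_v(G • x)`** (`M` normal; the orbit `{q.out • x}` is
permuted by `G` up to the stabiliser `U` of `x`). [folklore] -/
theorem smul_mem_orbitLayer
    (M : IntermediateField (v.adicCompletion K) (AlgebraicClosure (v.adicCompletion K)))
    [Normal (v.adicCompletion K) M] (G : Subgroup (absoluteGaloisGroup (v.adicCompletion K)))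
    (U : Subgroup G) (x : AlgebraicClosure (v.adicCompletion K))
    (hxU : ∀ u : G, u ∈ U → (u : absoluteGaloisGroup (v.adicCompletion K)) • x = x) (g : G)
    {z : AlgebraicClosure (v.adicCompletion K)}
    (hz : z ∈ M ⊔ IntermediateField.adjoin (v.adicCompletion K)
      (Set.range fun q : G ⧸ U ↦ ((q.out : G) : absoluteGaloisGroup (v.adicCompletion K)) • x)) :
    (g : absoluteGaloisGroup (v.adicCompletion K)) • z ∈
      M ⊔ IntermediateField.adjoin (v.adicCompletion K)
        (Set.range fun q : G ⧸ U ↦ ((q.out : G) : absoluteGaloisGroup (v.adicCompletion K)) • x) := by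
  set ĝ : AlgebraicClosure (v.adicCompletion K) ≃ₐ[v.adicCompletion K]
      AlgebraicClosure (v.adicCompletion K) :=
    absoluteGaloisGroup.toAlgEquiv (v.adicCompletion K)
      (g : absoluteGaloisGroup (v.adicCompletion K)) with hĝ
  have hmap : (M ⊔ IntermediateField.adjoin (v.adicCompletion K)
      (Set.range fun q : G ⧸ U ↦
        ((q.out : G) : absoluteGaloisGroup (v.adicCompletion K)) • x)).map
        (ĝ : AlgebraicClosure (v.adicCompletion K) →ₐ[v.adicCompletion K]
          AlgebraicClosure (v.adicCompletion K)) ≤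
      M ⊔ IntermediateField.adjoin (v.adicCompletion K)
        (Set.range fun q : G ⧸ U ↦
          ((q.out : G) : absoluteGaloisGroup (v.adicCompletion K)) • x) := by
    rw [IntermediateField.map_sup]
    refine sup_le_sup ((IntermediateField.normal_iff_forall_map_le'.mp inferInstance) ĝ) ?_
    rw [IntermediateField.adjoin_map]
    refine IntermediateField.adjoin.mono _ _ _ ?_
    rintro _ ⟨_, ⟨q, rfl⟩, rfl⟩
    change ĝ (((q.out : G) : absoluteGaloisGroup (v.adicCompletion K)) • x) ∈ _
    rw [show ĝ (((q.out : G) : absoluteGaloisGroup (v.adicCompletion K)) • x) =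
        ((g * q.out : G) : absoluteGaloisGroup (v.adicCompletion K)) • x by
      rw [Subgroup.coe_mul, mul_smul]; rfl]
    exact smul_mem_range_out_smul G U x hxU _
  exact hmap ⟨z, hz, rfl⟩

/-- **The layer `M ⊔ K_v(G • x)` is fixed pointwise by every `u ∈ U` fixing `M`**, `U` a NORMAL
subgroup of `G` fixing `x` (so `U` fixes the whole orbit of `x`). [folklore] -/
theorem smul_eq_self_of_mem_orbitLayer
    (M : IntermediateField (v.adicCompletion K) (AlgebraicClosure (v.adicCompletion K)))
    (G : Subgroup (absoluteGaloisGroup (v.adicCompletion K))) (U : Subgroup G) [U.Normal]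
    (x : AlgebraicClosure (v.adicCompletion K))
    (hxU : ∀ u : G, u ∈ U → (u : absoluteGaloisGroup (v.adicCompletion K)) • x = x)
    {u : G} (hu : u ∈ U)
    (huM : absoluteGaloisGroup.toAlgEquiv (v.adicCompletion K)
      (u : absoluteGaloisGroup (v.adicCompletion K)) ∈ M.fixingSubgroup)
    {z : AlgebraicClosure (v.adicCompletion K)}
    (hz : z ∈ M ⊔ IntermediateField.adjoin (v.adicCompletion K)
      (Set.range fun q : G ⧸ U ↦ ((q.out : G) : absoluteGaloisGroup (v.adicCompletion K)) • x)) :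
    (u : absoluteGaloisGroup (v.adicCompletion K)) • z = z := by
  -- the subgroup of `Gal(K̄_v/K_v)` of the elements of `U` fixing `M`
  set H' : Subgroup (AlgebraicClosure (v.adicCompletion K) ≃ₐ[v.adicCompletion K]
      AlgebraicClosure (v.adicCompletion K)) :=
    ((U.map G.subtype) ⊓ M.fixingSubgroup.comap
      (absoluteGaloisGroup.toAlgEquiv (v.adicCompletion K)).toMonoidHom).comap
      (absoluteGaloisGroup.toAlgEquiv (v.adicCompletion K)).symm.toMonoidHom with hH'def
  have hH'_mem : ∀ f, f ∈ H' ↔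
      (absoluteGaloisGroup.toAlgEquiv (v.adicCompletion K)).symm f ∈ U.map G.subtype ∧
        (absoluteGaloisGroup.toAlgEquiv (v.adicCompletion K)).symm f ∈ M.fixingSubgroup.comap
          (absoluteGaloisGroup.toAlgEquiv (v.adicCompletion K)).toMonoidHom :=
    fun _ ↦ by rw [hH'def, Subgroup.mem_comap, Subgroup.mem_inf]; rfl
  have hle : M ⊔ IntermediateField.adjoin (v.adicCompletion K)
      (Set.range fun q : G ⧸ U ↦
        ((q.out : G) : absoluteGaloisGroup (v.adicCompletion K)) • x) ≤
      IntermediateField.fixedField H' := by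
    refine sup_le ?_ ?_
    · rw [IntermediateField.le_iff_le]
      intro f hf
      have h1 := ((hH'_mem f).mp hf).2
      rw [Subgroup.mem_comap, MulEquiv.coe_toMonoidHom, MulEquiv.apply_symm_apply] at h1
      exact h1
    · rw [IntermediateField.adjoin_le_iff]
      rintro _ ⟨q, rfl⟩
      rw [SetLike.mem_coe, IntermediateField.mem_fixedField_iff]
      intro f hf
      set τ : absoluteGaloisGroup (v.adicCompletion K) :=
        (absoluteGaloisGroup.toAlgEquiv (v.adicCompletion K)).symm f with hτdef
      obtain ⟨⟨u', hu'U, hu'τ⟩, -⟩ := (hH'_mem f).mp hf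
      change τ • (((q.out : G) : absoluteGaloisGroup (v.adicCompletion K)) • x) = _
      have hτ : τ = (u' : absoluteGaloisGroup (v.adicCompletion K)) := hu'τ.symm
      have hconj : q.out⁻¹ * u' * q.out ∈ U := (inferInstance : U.Normal).conj_mem' u' hu'U _
      have := hxU _ hconj
      rw [Subgroup.coe_mul, Subgroup.coe_mul, Subgroup.coe_inv, mul_smul, mul_smul,
        inv_smul_eq_iff] at this
      rw [hτ]
      exact this
  have hz' := hle hz
  rw [IntermediateField.mem_fixedField_iff] at hz'
  have hmem : absoluteGaloisGroup.toAlgEquiv (v.adicCompletion K)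
      (u : absoluteGaloisGroup (v.adicCompletion K)) ∈ H' := by
    rw [hH'_mem, MulEquiv.symm_apply_apply]
    exact ⟨⟨u, hu, rfl⟩, huM⟩
  exact hz' _ hmem

/-- For subgroups `U₁ ≤ U₂` of `G` with `G/U₁` finite, `G/U₂` is finite. [folklore] -/
theorem finite_quotient_of_le {G : Type*} [Group G] {U₁ U₂ : Subgroup G} (h : U₁ ≤ U₂)
    [Finite (G ⧸ U₁)] : Finite (G ⧸ U₂) :=
  Finite.of_surjective (Subgroup.quotientMapOfLE h) fun q ↦
    Quotient.inductionOn' q fun g ↦ ⟨QuotientGroup.mk g, Subgroup.quotientMapOfLE_apply_mk h g⟩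

end Layer

/-! ## §2 Continuous cocycles: restriction to a subgroup, coboundaries -/

section Cocycles

variable (W : WeierstrassCurve K)

/-- **Restriction of a continuous crossed homomorphism to a subgroup** `N ≤ G ≤ Γ_{K_v}` (values in
`E(K̄_v)`): the composite with the inclusion is a continuous crossed homomorphism of `N`.
Serre, *Galois Cohomology*, I.§2.4–2.5. [folklore] -/
theorem exists_contOneCocycles_restrict {G N : Subgroup (absoluteGaloisGroup (v.adicCompletion K))}
    (hNG : N ≤ G)
    (φ : contOneCocycles (discreteTopRep G (localPoints W (v.adicCompletion K)))) :
    ∃ ψ : contOneCocycles (discreteTopRep N (localPoints W (v.adicCompletion K))),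
      ∀ n : N, ψ.1 n = φ.1 (Subgroup.inclusion hNG n) := by
  refine ⟨⟨(φ.1 : C(G, localPoints W (v.adicCompletion K))).comp
    ⟨Subgroup.inclusion hNG, continuous_inclusion hNG⟩, fun g h ↦ ?_⟩, fun n ↦ rfl⟩
  change φ.1 (Subgroup.inclusion hNG (g * h)) =
    φ.1 (Subgroup.inclusion hNG g) +
      (discreteTopRep N (localPoints W (v.adicCompletion K))).ρ g (φ.1 (Subgroup.inclusion hNG h))
  rw [map_mul, φ.2, discreteTopRep_ρ_apply, discreteTopRep_ρ_apply]
  rfl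

/-- The orbit map `σ ↦ σ • a` of a point `a ∈ E(K̄_v)` is continuous for the Krull topology on
`Γ_{K_v}` and the discrete topology on `E(K̄_v)` (the stabiliser of `a` is open,
`isOpen_stabilizer_localPoints`). Serre, *Galois Cohomology*, II.§1.1. [folklore] -/
theorem continuous_smul_localPoints (a : localPoints W (v.adicCompletion K)) :
    Continuous fun σ : absoluteGaloisGroup (v.adicCompletion K) ↦ σ • a := by
  refine continuous_def.mpr fun s _ ↦ ?_
  rw [isOpen_iff_forall_mem_open]
  intro σ₀ hσ₀
  refine ⟨(fun σ ↦ σ₀⁻¹ * σ) ⁻¹'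
    (MulAction.stabilizer (absoluteGaloisGroup (v.adicCompletion K)) a :
      Set (absoluteGaloisGroup (v.adicCompletion K))), fun σ hσ ↦ ?_, ?_, ?_⟩
  · have hfix : (σ₀⁻¹ * σ) • a = a := hσ
    rw [Set.mem_preimage] at hσ₀ ⊢
    rw [← mul_inv_cancel_left σ₀ σ, mul_smul, hfix]
    exact hσ₀
  · exact (WeierstrassCurve.isOpen_stabilizer_localPoints W (v.adicCompletion K) a).preimage
      (continuous_const.mul continuous_id)
  · change (σ₀⁻¹ * σ₀) • a = a
    rw [inv_mul_cancel, one_smul]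

/-- **The principal crossed homomorphism `g ↦ g • a − a` of a point `a ∈ E(K̄_v)` is a CONTINUOUS
cocycle** of any subgroup `G ≤ Γ_{K_v}`. Serre, *Galois Cohomology*, I.§2.2, I.§5.1. [folklore] -/
theorem exists_contOneCocycles_coboundary (G : Subgroup (absoluteGaloisGroup (v.adicCompletion K)))
    (a : localPoints W (v.adicCompletion K)) :
    ∃ δ : contOneCocycles (discreteTopRep G (localPoints W (v.adicCompletion K))),
      ∀ g : G, δ.1 g = (g : absoluteGaloisGroup (v.adicCompletion K)) • a - a := by
  have hcont : Continuous fun g : G ↦ (g : absoluteGaloisGroup (v.adicCompletion K)) • a - a :=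
    (continuous_of_discreteTopology (f := fun m : localPoints W (v.adicCompletion K) ↦ m - a)).comp
      ((continuous_smul_localPoints W a).comp continuous_subtype_val)
  refine ⟨⟨⟨fun g : G ↦ (g : absoluteGaloisGroup (v.adicCompletion K)) • a - a, hcont⟩,
    fun g h ↦ ?_⟩, fun g ↦ rfl⟩
  change ((g * h : G) : absoluteGaloisGroup (v.adicCompletion K)) • a - a =
    (g : absoluteGaloisGroup (v.adicCompletion K)) • a - a +
      (discreteTopRep G (localPoints W (v.adicCompletion K))).ρ g
        ((h : absoluteGaloisGroup (v.adicCompletion K)) • a - a)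
  rw [discreteTopRep_ρ_apply, Subgroup.coe_mul, mul_smul, smul_sub]
  change _ = _ + ((g : absoluteGaloisGroup (v.adicCompletion K)) •
    (h : absoluteGaloisGroup (v.adicCompletion K)) • a -
      (g : absoluteGaloisGroup (v.adicCompletion K)) • a)
  abel

end Cocycles

/-! ## §3 A normal subgroup fixing `S₀` fixes the normal closure of `K_v(S₀)` -/

section NormalClosure

/-- **A subgroup `N` NORMAL in `Γ_{K_v}` that fixes a set `S₀ ⊆ K̄_v` pointwise fixes the normal
closure of `K_v(S₀)` in `K̄_v` pointwise**: the fixed field of (the image in `Gal(K̄_v/K_v)` of) `N`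
is a NORMAL intermediate field containing `S₀` (`IntermediateField.normal_iff_forall_map_le'`,
`normalClosure_le_iff_of_normal`). [folklore] -/
theorem smul_eq_self_of_mem_normalClosure_adjoin
    (N : Subgroup (absoluteGaloisGroup (v.adicCompletion K))) [hNn : N.Normal]
    (S₀ : Set (AlgebraicClosure (v.adicCompletion K)))
    (hNS₀ : ∀ n ∈ N, ∀ z ∈ S₀, n • z = z) {n : absoluteGaloisGroup (v.adicCompletion K)}
    (hn : n ∈ N) {z : AlgebraicClosure (v.adicCompletion K)}
    (hz : z ∈ IntermediateField.normalClosure (v.adicCompletion K)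
      (IntermediateField.adjoin (v.adicCompletion K) S₀) (AlgebraicClosure (v.adicCompletion K))) :
    n • z = z := by
  haveI := isGalois_algebraicClosure_adicCompletion (v := v)
  set N' : Subgroup (AlgebraicClosure (v.adicCompletion K) ≃ₐ[v.adicCompletion K]
      AlgebraicClosure (v.adicCompletion K)) :=
    N.map (absoluteGaloisGroup.toAlgEquiv (v.adicCompletion K)).toMonoidHom with hN'def
  haveI hN'n : N'.Normal :=
    Subgroup.Normal.map hNn _ (absoluteGaloisGroup.toAlgEquiv (v.adicCompletion K)).surjective
  have hN'_mem : ∀ f, f ∈ N' ↔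
      (absoluteGaloisGroup.toAlgEquiv (v.adicCompletion K)).symm f ∈ N := by
    intro f
    rw [hN'def]
    constructor
    · rintro ⟨m, hm, rfl⟩
      rw [MulEquiv.coe_toMonoidHom, MulEquiv.symm_apply_apply]
      exact hm
    · intro hf
      exact ⟨_, hf, by rw [MulEquiv.coe_toMonoidHom, MulEquiv.apply_symm_apply]⟩
  set F : IntermediateField (v.adicCompletion K) (AlgebraicClosure (v.adicCompletion K)) :=
    IntermediateField.fixedField N' with hFdef
  have hF_mem : ∀ z, z ∈ F ↔ ∀ m ∈ N, m • z = z := by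
    intro z
    rw [hFdef, IntermediateField.mem_fixedField_iff]
    constructor
    · intro h m hm
      exact h (absoluteGaloisGroup.toAlgEquiv (v.adicCompletion K) m)
        ((hN'_mem _).2 (by rw [MulEquiv.symm_apply_apply]; exact hm))
    · intro h f hf
      have e : ((absoluteGaloisGroup.toAlgEquiv (v.adicCompletion K)).symm f) • z = f z := by
        change (absoluteGaloisGroup.toAlgEquiv (v.adicCompletion K)
          ((absoluteGaloisGroup.toAlgEquiv (v.adicCompletion K)).symm f)) z = f z
        rw [MulEquiv.apply_symm_apply]
      rw [← e]
      exact h _ ((hN'_mem f).1 hf)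
  haveI hFn : Normal (v.adicCompletion K) F := by
    refine IntermediateField.normal_iff_forall_map_le'.mpr fun s ↦ ?_
    intro y hy
    obtain ⟨z, hz, rfl⟩ := (IntermediateField.mem_map _).mp hy
    rw [hFdef, IntermediateField.mem_fixedField_iff] at hz
    rw [hFdef, IntermediateField.mem_fixedField_iff]
    intro f hf
    have hconj : s⁻¹ * f * s ∈ N' := hN'n.conj_mem' f hf s
    have h1 := hz _ hconj
    rw [AlgEquiv.mul_apply, AlgEquiv.mul_apply, AlgEquiv.aut_inv] at h1
    have h2 := congrArg s h1
    rw [AlgEquiv.apply_symm_apply] at h2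
    exact h2
  have hle : IntermediateField.normalClosure (v.adicCompletion K)
      (IntermediateField.adjoin (v.adicCompletion K) S₀) (AlgebraicClosure (v.adicCompletion K)) ≤
      F := by
    rw [IntermediateField.normalClosure_le_iff_of_normal, IntermediateField.adjoin_le_iff]
    intro z hz
    exact (hF_mem z).2 fun m hm ↦ hNS₀ m hm z hz
  exact (hF_mem z).1 (hle hz) n hn

end NormalClosure

end Summit.BirchSwinnertonDyer.BirchSwinnertonDyer.Theorems.GoodModelKernelH1OfSubquotient

end
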